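import Literature.Topology.FourManifolds.GompfFramedTwistTransport
import Literature.Topology.FourManifolds.GompfSectionCircleFramings
import HarnessLib

/-!
# Existence of straightenings with exactly linear germs, for every `A ∈ SL(3, ℤ)`

Third infrastructure file for the framed form of Gompf's Theorem 2.1
(`Literature.Topology.FourManifolds.gompf2010_framedTwist`; R. Gompf, *More Cappell–Shaneson
spheres are standard*, Algebr. Geom. Topol. 10 (2010)). `GompfFramedTwistTransport.lean`
introduced the structure `Straightening A` — a based diffeotopy of `T³` from the identity whose
stages are *exactly linear* in exponential coordinates near the base point, ending at a map with
linear part `A⁻¹` — and proved that such a straightening identifies Gompf's framed sphere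
`gompfSphere A γ` (`γ` in the straightening class of `S.path`) with the product-framed surgery
`S.prodSphere` of the straightened mapping torus, whose monodromy is the identity near the base
point (Gompf 2010, §2 ¶1: "we may assume `φ` restricts to the identity in a neighborhood of some
point `p ∈ M`"; §3 ¶1: "straightening the corresponding linear diffeomorphism of `T³` to the
identity near `0`"; §4 Def. 4.1 and ¶2). `GompfShearModel.lean` gave one example by a closed
formula. Here we prove that **every** `A ∈ SL(3, ℤ)` has a straightening
(`Literature.Topology.FourManifolds.linearStraightening A : Straightening A`,
`Literature.Topology.FourManifolds.nonempty_straightening`), by the classical construction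
(Hirsch, *Differential Topology*, Ch. 8 §3, proof of Thm 3.1: a smooth path in `GL(n)` through
near-identity steps, each realised by a compactly supported diffeomorphism "by inserting a bump
function"):

* `Literature.Topology.FourManifolds.torusPush`, `Literature.Topology.FourManifolds.Diffeotopy.torusExtend` —
  **extension by the identity through exponential coordinates**: a diffeotopy of `ℝ³` whose
  stages are the identity off a ball `B̄(0, R)`, `R < π`, is pushed to a diffeotopy of `T³`
  (`z ↦ expT (F (logT z))`), with stages `expT v ↦ expT (F v)` on the open cube
  (`torusExtend_toFun_expT`);
* `Literature.Topology.FourManifolds.Diffeotopy.ofFamily` — a jointly smooth family of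
  diffeomorphisms of a complete normed space, starting at the identity, is a diffeotopy (its track
  is a fibrewise family of diffeomorphisms, `fibrewiseDiffeomorph`);
* `Literature.Topology.FourManifolds.segOp κ N = 1 + κ (N - 1)`,
  `Literature.Topology.FourManifolds.straightenPathFun ρ l t` — the **straightening path**: the
  iterated near-identity straightening (`straightenListFun`, `GompfConjInvariance.lean`) of the
  segment operators `1 + λ(t) (N_k - 1)` of a list `l = [N_1, …, N_m]` of near-identity factors,
  `λ = Real.smoothTransition`; jointly smooth, each stage a compactly supported diffeomorphism,
  the identity at `t = 0`, and exactly linear with operator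
  `Literature.Topology.FourManifolds.segProd l t = ∏ₖ (1 + λ(t)(N_k - 1))` on a fixed ball
  (`straightenPathFun_of_norm_le`); `segProd l 0 = 1`, `segProd l 1 = l.prod`, `segProd l t` is
  invertible with inverse `Literature.Topology.FourManifolds.segProdInv l t`, both smooth in `t`;
* `Literature.Topology.FourManifolds.linearStraightening A` — the straightening of `A` obtained
  from the near-identity factorisation `straightenInvFactors A` of `A⁻¹`
  (`GompfFramedTwistTransport.lean`, from a path in `GL⁺(3, ℝ)`), and the consequence
  `Literature.Topology.FourManifolds.nonempty_diffeomorph_gompfSphere_prodSphere_linearStraightening`: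
  `gompfSphere A γ ≃ₘ (linearStraightening A).prodSphere` for every framing path `γ` in the class
  of `(linearStraightening A).path`.

Everything here is proved; no named facts are introduced.

## References

* R. E. Gompf, *More Cappell–Shaneson spheres are standard*, Algebr. Geom. Topol. 10 (2010)
  1665–1681: §2 ¶1, §3 ¶1, §4 Def. 4.1 and ¶2. [GompfAGT2010]
* M. W. Hirsch, *Differential Topology*, GTM 33 (1976), Ch. 8 §1 (Thms. 1.3–1.4: extension of
  compactly supported diffeotopies) and §3, proof of Thm 3.1. [Hirsch1976]
-/

open scoped Manifold ContDiff Topology Real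
open Set Function Metric Filter

noncomputable section

namespace Literature.Topology.FourManifolds

/-- Local notation: `𝔼 n` is the model Euclidean space `EuclideanSpace ℝ (Fin n)`. -/
local notation "𝔼 " n:arg => EuclideanSpace ℝ (Fin n)

/-- Local notation: the model with corners `𝓣 = (𝓡 1).prod ((𝓡 1).prod (𝓡 1))` of `ThreeTorus`. -/
local notation "𝓣" =>
  (ModelWithCorners.prod (𝓡 1) (ModelWithCorners.prod (𝓡 1) (𝓡 1)))

attribute [local instance] finrank_real_complex_fact'

/-! ### Euclidean norms on `𝔼 3`: cubes and balls -/

section Norms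

/-- The open cube of half-width `R` lies in the ball of radius `2R`. [folklore] -/
theorem norm_lt_two_mul_of_abs_lt {R : ℝ} {v : 𝔼 3} (hv : ∀ i, |v i| < R) : ‖v‖ < 2 * R := by
  have hR : 0 < R := (abs_nonneg _).trans_lt (hv 0)
  have hsq : ∀ i, ‖v i‖ ^ 2 < R ^ 2 := fun i ↦ by
    rw [Real.norm_eq_abs, ← sq_abs R]
    exact pow_lt_pow_left₀ ((hv i).trans_le (le_abs_self R)) (abs_nonneg _) two_ne_zero
  have hsum : ∑ i, ‖v i‖ ^ 2 < (2 * R) ^ 2 := by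
    rw [Fin.sum_univ_three]
    nlinarith [hsq 0, hsq 1, hsq 2]
  rw [EuclideanSpace.norm_eq]
  calc √(∑ i, ‖v i‖ ^ 2) < √((2 * R) ^ 2) := Real.sqrt_lt_sqrt (by positivity) hsum
    _ = 2 * R := Real.sqrt_sq (by positivity)

/-- `logT 1 = 0`. [folklore] -/
@[simp] theorem logT_one : logT (1 : ThreeTorus) = 0 := by
  rw [← expT_zero]
  exact logT_expT_of_abs_lt fun j ↦ by simpa using Real.pi_pos

end Norms

/-! ### Pushing compactly supported maps of `ℝ³` to `T³` through exponential coordinates -/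

section TorusPush

/-- **The push of a self-map of `ℝ³` to `T³` through exponential coordinates**:
`z ↦ expT (F (logT z))`. For `F` the identity off a ball `B̄(0, R)` with `R < π` this is
`expT ∘ F ∘ logT` on `expT (B(0, π))` and the identity elsewhere, i.e. the extension by the
identity of a compactly supported map of the chart domain (Hirsch 1976, Ch. 8 §1). [cite: Hirsch1976, Ch. 8 §3, proof of Thm 3.1 (inserting a bump function)] -/
def torusPush (F : 𝔼 3 → 𝔼 3) (z : ThreeTorus) : ThreeTorus :=
  expT (F (logT z))

/-- On the open cube the push is `expT v ↦ expT (F v)`. [folklore] -/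
theorem torusPush_expT (F : 𝔼 3 → 𝔼 3) {v : 𝔼 3} (hv : ∀ j, |v j| < π) :
    torusPush F (expT v) = expT (F v) := by
  rw [torusPush, logT_expT_of_abs_lt hv]

/-- The push of the identity is the identity. [folklore] -/
@[simp] theorem torusPush_id : torusPush (id : 𝔼 3 → 𝔼 3) = id := by
  funext z
  simp [torusPush]

/-- The push fixes the base point as soon as `F` fixes `0`. [folklore] -/
theorem torusPush_one {F : 𝔼 3 → 𝔼 3} (hF : F 0 = 0) : torusPush F 1 = 1 := by
  rw [torusPush, logT_one, hF, expT_zero]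

/-- Off `expT (B̄(0, R))` the push of a map supported in `B̄(0, R)` is the identity. [folklore] -/
theorem torusPush_of_not_mem {F : 𝔼 3 → 𝔼 3} {R : ℝ} (hF : ∀ v, R ≤ ‖v‖ → F v = v)
    {z : ThreeTorus} (hz : z ∉ expT '' closedBall (0 : 𝔼 3) R) : torusPush F z = z := by
  have h : R ≤ ‖logT z‖ := by
    by_contra h
    exact hz ⟨logT z, mem_closedBall_zero_iff.2 (not_le.1 h).le, expT_logT z⟩
  rw [torusPush, hF _ h, expT_logT]

/-- An injective map that is the identity off `B(0, R)` maps `B(0, R)` into itself. [folklore] -/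
theorem norm_lt_of_injective_of_eq_self {F : 𝔼 3 → 𝔼 3} (hinj : Injective F) {R : ℝ}
    (hF : ∀ v, R ≤ ‖v‖ → F v = v) {v : 𝔼 3} (hv : ‖v‖ < R) : ‖F v‖ < R := by
  by_contra h'
  have h1 : F (F v) = F v := hF _ (not_lt.1 h')
  rw [hinj h1] at h'
  exact h' hv

/-- **Pushes compose like the maps** when the inner map is injective and supported in a ball of
radius `< π`: `push G (push F z) = z` if `G ∘ F = id`. [folklore] -/
theorem torusPush_torusPush {F G : 𝔼 3 → 𝔼 3} {R : ℝ} (hR : R < π)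
    (hF : ∀ v, R ≤ ‖v‖ → F v = v) (hinj : Injective F) (hGF : ∀ v, G (F v) = v)
    (z : ThreeTorus) : torusPush G (torusPush F z) = z := by
  by_cases h : R ≤ ‖logT z‖
  · have hG : G (logT z) = logT z := by
      conv_lhs => rw [← hF _ h]
      exact hGF _
    rw [torusPush, torusPush, hF _ h, expT_logT, hG, expT_logT]
  · have hFv : ‖F (logT z)‖ < R := norm_lt_of_injective_of_eq_self hinj hF (not_le.1 h)
    rw [torusPush, torusPush,
      logT_expT_of_abs_lt fun j ↦ ((Real.norm_eq_abs _).symm.le.trans (PiLp.norm_apply_le _ j)).trans_lt (hFv.trans hR), hGF,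
      expT_logT]

/-- **Joint smoothness of the pushed family.** If `Φ : ℝ × ℝ³ → ℝ³` is jointly smooth and every
`Φ_t` is the identity off `B̄(0, R)`, `R < π`, then `(t, z) ↦ push (Φ_t) z` is jointly smooth:
near `ℝ × (slit torus)` it is the composite `expT ∘ Φ ∘ (id × logT)`, and near the closed set
`ℝ × (T³ ∖ expT (B̄(0, R)))` it is the identity. [cite: Hirsch1976, Ch. 8 §3, proof of Thm 3.1 (inserting a bump function)] -/
theorem contMDiff_torusPush_uncurry {Φ : ℝ → 𝔼 3 → 𝔼 3}
    (hΦ : ContMDiff (𝓘(ℝ, ℝ).prod 𝓘(ℝ, 𝔼 3)) 𝓘(ℝ, 𝔼 3) ∞ (uncurry Φ)) {R : ℝ} (hR : R < π)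
    (hfix : ∀ t v, R ≤ ‖v‖ → Φ t v = v) :
    ContMDiff (𝓘(ℝ, ℝ).prod 𝓣) 𝓣 ∞ (uncurry fun t z ↦ torusPush (Φ t) z) := by
  rintro ⟨t, z⟩
  by_cases hz : z ∈ torusSlit
  · have h0 : ContMDiffAt 𝓣 𝓘(ℝ, 𝔼 3) ∞ logT z :=
      contMDiffOn_logT.contMDiffAt (isOpen_torusSlit.mem_nhds hz)
    have h0' : ContMDiffAt (𝓘(ℝ, ℝ).prod 𝓣) 𝓘(ℝ, 𝔼 3) ∞ (fun q : ℝ × ThreeTorus ↦ logT q.2) (t, z) :=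
      h0.comp_of_eq (contMDiffAt_snd (p := (t, z))) rfl
    have h1 : ContMDiffAt (𝓘(ℝ, ℝ).prod 𝓣) (𝓘(ℝ, ℝ).prod 𝓘(ℝ, 𝔼 3)) ∞
        (fun q : ℝ × ThreeTorus ↦ (q.1, logT q.2)) (t, z) :=
      contMDiffAt_fst.prodMk h0'
    have h2 : ContMDiffAt (𝓘(ℝ, ℝ).prod 𝓣) 𝓘(ℝ, 𝔼 3) ∞
        (fun q : ℝ × ThreeTorus ↦ Φ q.1 (logT q.2)) (t, z) :=
      hΦ.contMDiffAt.comp (t, z) h1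
    exact contMDiff_expT.contMDiffAt.comp (t, z) h2
  · have hK : IsClosed (expT '' closedBall (0 : 𝔼 3) R) :=
      ((isCompact_closedBall _ _).image continuous_expT).isClosed
    have hzK : z ∉ expT '' closedBall (0 : 𝔼 3) R := by
      rintro ⟨v, hv, rfl⟩
      exact hz (expT_mem_torusSlit fun j ↦
        ((Real.norm_eq_abs _).symm.le.trans (PiLp.norm_apply_le v j)).trans_lt
          ((mem_closedBall_zero_iff.1 hv).trans_lt hR))
    have hev : (uncurry fun t z ↦ torusPush (Φ t) z) =ᶠ[𝓝 (t, z)] fun q ↦ q.2 := by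
      filter_upwards [prod_mem_nhds Filter.univ_mem (hK.isOpen_compl.mem_nhds hzK)] with q hq
      exact torusPush_of_not_mem (hfix q.1) hq.2
    exact contMDiffAt_snd.congr_of_eventuallyEq hev

namespace Diffeotopy

/-- If all stages of a diffeotopy of `ℝ³` are the identity off `B̄(0, R)`, so are all inverse
stages. [folklore] -/
theorem invFun_eq_self_of_toFun' (D : Diffeotopy 𝓘(ℝ, 𝔼 3) (𝔼 3)) {R : ℝ}
    (hD : ∀ t v, R ≤ ‖v‖ → D.toFun t v = v) (t : ℝ) (v : 𝔼 3) (hv : R ≤ ‖v‖) :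
    D.invFun t v = v := by
  conv_lhs => rw [← hD t v hv]
  exact D.invFun_toFun t v

/-- Stages of a diffeotopy are injective. [folklore] -/
theorem toFun_injective {EN HN : Type*} [NormedAddCommGroup EN] [NormedSpace ℝ EN]
    [TopologicalSpace HN] {J : ModelWithCorners ℝ EN HN} {N : Type*} [TopologicalSpace N]
    [ChartedSpace HN N] (D : Diffeotopy J N) (t : ℝ) : Injective (D.toFun t) :=
  (LeftInverse.injective fun x ↦ D.invFun_toFun t x)

/-- Inverse stages of a diffeotopy are injective. [folklore] -/
theorem invFun_injective {EN HN : Type*} [NormedAddCommGroup EN] [NormedSpace ℝ EN]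
    [TopologicalSpace HN] {J : ModelWithCorners ℝ EN HN} {N : Type*} [TopologicalSpace N]
    [ChartedSpace HN N] (D : Diffeotopy J N) (t : ℝ) : Injective (D.invFun t) :=
  (LeftInverse.injective fun y ↦ D.toFun_invFun t y)

/-- **Extension by the identity through exponential coordinates**: a diffeotopy of `ℝ³` supported
in `B̄(0, R)`, `R < π`, pushed stagewise to a diffeotopy of `T³`. Hirsch (1976), Ch. 8 §1,
Thms. 1.3–1.4 (extension of compactly supported diffeotopies of open subsets), here flow-free in
the chart `expT`. [cite: Hirsch1976, Ch. 8 §3, proof of Thm 3.1 (inserting a bump function)] -/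
def torusExtend (D : Diffeotopy 𝓘(ℝ, 𝔼 3) (𝔼 3)) {R : ℝ} (hR : R < π)
    (hD : ∀ t v, R ≤ ‖v‖ → D.toFun t v = v) : Diffeotopy 𝓣 ThreeTorus :=
  Diffeotopy.mk' 𝓣 (fun t ↦ torusPush (D.toFun t)) (fun t ↦ torusPush (D.invFun t))
    (contMDiff_torusPush_uncurry D.contMDiff_uncurry_toFun hR hD)
    (contMDiff_torusPush_uncurry D.contMDiff_uncurry_invFun hR (D.invFun_eq_self_of_toFun' hD))
    (fun t z ↦ torusPush_torusPush hR (hD t) (D.toFun_injective t) (D.invFun_toFun t) z)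
    (fun t z ↦ torusPush_torusPush hR (D.invFun_eq_self_of_toFun' hD t) (D.invFun_injective t)
      (D.toFun_invFun t) z)
    (by rw [D.toFun_zero, torusPush_id])

/-- Stages of the extension (definitional). [folklore] -/
@[simp] theorem torusExtend_toFun (D : Diffeotopy 𝓘(ℝ, 𝔼 3) (𝔼 3)) {R : ℝ} (hR : R < π)
    (hD : ∀ t v, R ≤ ‖v‖ → D.toFun t v = v) (t : ℝ) :
    (D.torusExtend hR hD).toFun t = torusPush (D.toFun t) := rfl

/-- Inverse stages of the extension (definitional). [folklore] -/
@[simp] theorem torusExtend_invFun (D : Diffeotopy 𝓘(ℝ, 𝔼 3) (𝔼 3)) {R : ℝ} (hR : R < π)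
    (hD : ∀ t v, R ≤ ‖v‖ → D.toFun t v = v) (t : ℝ) :
    (D.torusExtend hR hD).invFun t = torusPush (D.invFun t) := rfl

/-- **The extension in exponential coordinates**: `F_t (expT v) = expT (D_t v)` on the open cube
`|vⱼ| < π`. [folklore] -/
theorem torusExtend_toFun_expT (D : Diffeotopy 𝓘(ℝ, 𝔼 3) (𝔼 3)) {R : ℝ} (hR : R < π)
    (hD : ∀ t v, R ≤ ‖v‖ → D.toFun t v = v) (t : ℝ) {v : 𝔼 3} (hv : ∀ j, |v j| < π) :
    (D.torusExtend hR hD).toFun t (expT v) = expT (D.toFun t v) :=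
  torusPush_expT _ hv

/-- The inverse stages in exponential coordinates. [folklore] -/
theorem torusExtend_invFun_expT (D : Diffeotopy 𝓘(ℝ, 𝔼 3) (𝔼 3)) {R : ℝ} (hR : R < π)
    (hD : ∀ t v, R ≤ ‖v‖ → D.toFun t v = v) (t : ℝ) {v : 𝔼 3} (hv : ∀ j, |v j| < π) :
    (D.torusExtend hR hD).invFun t (expT v) = expT (D.invFun t v) :=
  torusPush_expT _ hv

/-- Every stage of the extension fixes the base point `1 = expT 0` as soon as the Euclidean stage
fixes `0`. [folklore] -/
theorem torusExtend_toFun_one (D : Diffeotopy 𝓘(ℝ, 𝔼 3) (𝔼 3)) {R : ℝ} (hR : R < π)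
    (hD : ∀ t v, R ≤ ‖v‖ → D.toFun t v = v) (t : ℝ) (h0 : D.toFun t 0 = 0) :
    (D.torusExtend hR hD).toFun t 1 = 1 :=
  torusPush_one h0

end Diffeotopy

end TorusPush

/-! ### Diffeotopies of a normed space from jointly smooth families of diffeomorphisms -/

section OfFamily

variable {E : Type*} [NormedAddCommGroup E] [NormedSpace ℝ E]

/-- A `C^n` map on `ℝ × E` is `C^n` for the product model `𝓘(ℝ, ℝ).prod 𝓘(ℝ, E)` of the track of
a diffeotopy (Mathlib's `modelWithCornersSelf_prod` / `chartedSpaceSelf_prod`). [folklore] -/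
theorem contMDiff_real_prod_of_contDiff {G : Type*} [NormedAddCommGroup G] [NormedSpace ℝ G]
    {m : WithTop ℕ∞} {g : ℝ × E → G} (hg : ContDiff ℝ m g) :
    ContMDiff (𝓘(ℝ, ℝ).prod 𝓘(ℝ, E)) 𝓘(ℝ, G) m g := by
  rw [← modelWithCornersSelf_prod, chartedSpaceSelf_prod]
  exact hg.contMDiff

variable [CompleteSpace E]

namespace Diffeotopy

/-- **A jointly smooth family of diffeomorphisms starting at the identity is a diffeotopy**: its
track `(t, v) ↦ (t, Φ_t v)` is a fibrewise family of diffeomorphisms over `ℝ`, hence a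
diffeomorphism of `ℝ × E` (`fibrewiseDiffeomorph`, inverse function theorem). Hirsch (1976),
Ch. 8 §1 (diffeotopy = isotopy through diffeomorphisms; its track). [cite: HirschDT1976, Ch. 8 §1, p. 178] -/
def ofFamily (Φ : ℝ → E → E) (hΦ : ContDiff ℝ ∞ (uncurry Φ))
    (hdiff : ∀ t, ∃ e : E ≃ₘ⟮𝓘(ℝ, E), 𝓘(ℝ, E)⟯ E, ⇑e = Φ t) (h0 : Φ 0 = id) :
    Diffeotopy 𝓘(ℝ, E) E where
  track := fibrewiseDiffeomorph (J := 𝓘(ℝ, ℝ)) (F := Φ) (contMDiff_real_prod_of_contDiff hΦ)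
    (fun t ↦ by
      obtain ⟨e, he⟩ := hdiff t
      rw [← he]
      exact e.isLocalDiffeomorph)
    (fun t ↦ by
      obtain ⟨e, he⟩ := hdiff t
      rw [← he]
      exact e.bijective)
  track_fst _ := rfl
  track_zero x := by
    change Φ 0 x = x
    rw [h0, id]

/-- Stages of `Diffeotopy.ofFamily` (definitional). [folklore] -/
@[simp] theorem ofFamily_toFun (Φ : ℝ → E → E) (hΦ : ContDiff ℝ ∞ (uncurry Φ))
    (hdiff : ∀ t, ∃ e : E ≃ₘ⟮𝓘(ℝ, E), 𝓘(ℝ, E)⟯ E, ⇑e = Φ t) (h0 : Φ 0 = id) :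
    (ofFamily Φ hΦ hdiff h0).toFun = Φ := rfl

end Diffeotopy

end OfFamily

/-! ### Segment operators and the straightening path -/

section Segment

variable {E : Type*} [NormedAddCommGroup E] [NormedSpace ℝ E]

/-- **The segment operator** `1 + κ (N - 1)`: the straight segment from `1` (`κ = 0`) to `N`
(`κ = 1`). [folklore] -/
def segOp (κ : ℝ) (N : E →L[ℝ] E) : E →L[ℝ] E := 1 + κ • (N - 1)

/-- `segOp 0 N = 1`. [folklore] -/
@[simp] theorem segOp_zero (N : E →L[ℝ] E) : segOp 0 N = 1 := by simp [segOp]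

/-- `segOp 1 N = N`. [folklore] -/
@[simp] theorem segOp_one (N : E →L[ℝ] E) : segOp 1 N = N := by simp [segOp]

/-- `segOp κ N - 1 = κ (N - 1)`. [folklore] -/
theorem segOp_sub_one (κ : ℝ) (N : E →L[ℝ] E) : segOp κ N - 1 = κ • (N - 1) :=
  add_sub_cancel_left _ _

/-- For `|κ| ≤ 1` the segment operator is at least as close to `1` as `N`. [folklore] -/
theorem norm_segOp_sub_one_le {κ : ℝ} (hκ : |κ| ≤ 1) (N : E →L[ℝ] E) :
    ‖segOp κ N - 1‖ ≤ ‖N - 1‖ := by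
  rw [segOp_sub_one, norm_smul, Real.norm_eq_abs]
  exact mul_le_of_le_one_left (norm_nonneg _) hκ

/-- The segment operator is smooth in `κ`. [folklore] -/
theorem contDiff_segOp (N : E →L[ℝ] E) : ContDiff ℝ ∞ fun κ ↦ segOp κ N :=
  contDiff_const.add (contDiff_id.smul contDiff_const)

/-- `|Real.smoothTransition t| ≤ 1`. [folklore] -/
theorem abs_smoothTransition_le_one (t : ℝ) : |Real.smoothTransition t| ≤ 1 := by
  rw [abs_of_nonneg (Real.smoothTransition.nonneg t)]
  exact Real.smoothTransition.le_one t

/-- **The segment list** of a list of operators at time `t`: each `N` replaced by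
`1 + λ(t) (N - 1)`, `λ = Real.smoothTransition` (so that the list is constant for `t ≤ 0` and for
`t ≥ 1`). [folklore] -/
def segList (l : List (E →L[ℝ] E)) (t : ℝ) : List (E →L[ℝ] E) :=
  l.map (segOp (Real.smoothTransition t))

/-- The segment list of the empty list. [folklore] -/
@[simp] theorem segList_nil (t : ℝ) : segList ([] : List (E →L[ℝ] E)) t = [] := rfl

/-- The segment list of `N :: l`. [folklore] -/
theorem segList_cons (N : E →L[ℝ] E) (l : List (E →L[ℝ] E)) (t : ℝ) :
    segList (N :: l) t = segOp (Real.smoothTransition t) N :: segList l t := rfl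

/-- The segment list has the same length. [folklore] -/
@[simp] theorem length_segList (l : List (E →L[ℝ] E)) (t : ℝ) : (segList l t).length = l.length :=
  List.length_map _

/-- At `t = 1` the segment list is the list. [folklore] -/
theorem segList_one (l : List (E →L[ℝ] E)) : segList l 1 = l := by
  induction l with
  | nil => rfl
  | cons N l ih => rw [segList_cons, ih, Real.smoothTransition.one, segOp_one]

/-- At `t = 0` every member of the segment list is `1`. [folklore] -/
theorem eq_one_of_mem_segList_zero (l : List (E →L[ℝ] E)) {L : E →L[ℝ] E} (hL : L ∈ segList l 0) :
    L = 1 := by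
  obtain ⟨N, -, rfl⟩ := List.mem_map.1 hL
  rw [Real.smoothTransition.zero, segOp_zero]

/-- Members of the segment list are as close to `1` as the members of the list. [folklore] -/
theorem norm_sub_one_le_of_mem_segList {l : List (E →L[ℝ] E)} {η : ℝ} (h : ∀ N ∈ l, ‖N - 1‖ ≤ η)
    (t : ℝ) : ∀ L ∈ segList l t, ‖L - 1‖ ≤ η := by
  intro L hL
  obtain ⟨N, hN, rfl⟩ := List.mem_map.1 hL
  exact (norm_segOp_sub_one_le (abs_smoothTransition_le_one t) N).trans (h N hN)

/-- **The segment product** `∏ₖ (1 + λ(t)(N_k - 1))`: the linear part of the straightening path at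
time `t`. [folklore] -/
def segProd (l : List (E →L[ℝ] E)) (t : ℝ) : E →L[ℝ] E := (segList l t).prod

/-- The segment product of `N :: l`. [folklore] -/
theorem segProd_cons (N : E →L[ℝ] E) (l : List (E →L[ℝ] E)) (t : ℝ) :
    segProd (N :: l) t = segOp (Real.smoothTransition t) N * segProd l t := by
  rw [segProd, segList_cons, List.prod_cons, segProd]

/-- `segProd l 0 = 1`. [folklore] -/
@[simp] theorem segProd_zero (l : List (E →L[ℝ] E)) : segProd l 0 = 1 :=
  List.prod_eq_one fun _ hL ↦ eq_one_of_mem_segList_zero l hL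

/-- `segProd l 1 = l.prod`. [folklore] -/
@[simp] theorem segProd_one (l : List (E →L[ℝ] E)) : segProd l 1 = l.prod := by
  rw [segProd, segList_one]

/-- The segment product is smooth in `t`. [folklore] -/
theorem contDiff_segProd (l : List (E →L[ℝ] E)) : ContDiff ℝ ∞ (segProd l) := by
  induction l with
  | nil =>
    have h : segProd ([] : List (E →L[ℝ] E)) = fun _ ↦ 1 := funext fun t ↦ rfl
    rw [h]
    exact contDiff_const
  | cons N l ih =>
    have h : segProd (N :: l) = fun t ↦ segOp (Real.smoothTransition t) N * segProd l t :=
      funext (segProd_cons N l)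
    rw [h]
    exact ((contDiff_segOp N).comp Real.smoothTransition.contDiff).mul ih

/-- **Lower bound of the segment product**: `‖y‖ ≤ (6/5)^m ‖(segProd l t) y‖` for `m` factors
within `1/6` of `1` (each factor shrinks norms by at most `5/6`). [folklore] -/
theorem norm_le_pow_mul_norm_segProd {l : List (E →L[ℝ] E)} (h : ∀ N ∈ l, ‖N - 1‖ ≤ 1 / 6) (t : ℝ)
    (y : E) : ‖y‖ ≤ (6 / 5) ^ l.length * ‖segProd l t y‖ := by
  induction l generalizing y with
  | nil => simp [segProd]
  | cons N l ih =>
    have hl : ∀ M ∈ l, ‖M - 1‖ ≤ 1 / 6 := fun M hM ↦ h M (List.mem_cons_of_mem _ hM)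
    have key : ∀ w : E, ‖w‖ ≤ 6 / 5 * ‖segOp (Real.smoothTransition t) N w‖ := fun w ↦ by
      have h1 : ‖segOp (Real.smoothTransition t) N w - w‖ ≤ 1 / 6 * ‖w‖ :=
        calc ‖segOp (Real.smoothTransition t) N w - w‖
            = ‖(segOp (Real.smoothTransition t) N - 1) w‖ := rfl
          _ ≤ ‖segOp (Real.smoothTransition t) N - 1‖ * ‖w‖ := ContinuousLinearMap.le_opNorm _ _
          _ ≤ 1 / 6 * ‖w‖ := mul_le_mul_of_nonneg_right
              ((norm_segOp_sub_one_le (abs_smoothTransition_le_one t) N).trans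
                (h N List.mem_cons_self)) (norm_nonneg _)
      have h2 : ‖w‖ ≤ ‖segOp (Real.smoothTransition t) N w‖ +
          ‖segOp (Real.smoothTransition t) N w - w‖ :=
        calc ‖w‖ = ‖segOp (Real.smoothTransition t) N w - (segOp (Real.smoothTransition t) N w - w)‖ := by
              rw [sub_sub_cancel]
          _ ≤ _ := norm_sub_le _ _
      linarith
    rw [segProd_cons, List.length_cons, pow_succ]
    calc ‖y‖ ≤ (6 / 5) ^ l.length * ‖segProd l t y‖ := ih hl y
      _ ≤ (6 / 5) ^ l.length * (6 / 5 * ‖segOp (Real.smoothTransition t) N (segProd l t y)‖) :=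
          mul_le_mul_of_nonneg_left (key _) (by positivity)
      _ = (6 / 5) ^ l.length * (6 / 5) * ‖segOp (Real.smoothTransition t) N (segProd l t y)‖ := by
          ring

/-- **The inverse of the segment product** (`Ring.inverse`, a genuine inverse by
`isUnit_segProd`). [folklore] -/
def segProdInv (l : List (E →L[ℝ] E)) (t : ℝ) : E →L[ℝ] E := Ring.inverse (segProd l t)

/-- `segProdInv l 0 = 1`. [folklore] -/
@[simp] theorem segProdInv_zero (l : List (E →L[ℝ] E)) : segProdInv l 0 = 1 := by
  rw [segProdInv, segProd_zero, Ring.inverse_one]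

variable [CompleteSpace E]

/-- A segment operator of a factor within `1/6` of `1` is invertible. [folklore] -/
theorem isUnit_segOp {κ : ℝ} (hκ : |κ| ≤ 1) {N : E →L[ℝ] E} (hN : ‖N - 1‖ ≤ 1 / 6) :
    IsUnit (segOp κ N) := by
  have h : ‖-(κ • (N - 1))‖ < 1 := by
    rw [norm_neg, ← segOp_sub_one]
    exact ((norm_segOp_sub_one_le hκ N).trans hN).trans_lt (by norm_num)
  have := isUnit_one_sub_of_norm_lt_one h
  rwa [sub_neg_eq_add] at this

/-- **The segment product of factors within `1/6` of `1` is invertible.** [folklore] -/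
theorem isUnit_segProd {l : List (E →L[ℝ] E)} (h : ∀ N ∈ l, ‖N - 1‖ ≤ 1 / 6) (t : ℝ) :
    IsUnit (segProd l t) := by
  induction l with
  | nil => exact isUnit_one
  | cons N l ih =>
    rw [segProd_cons]
    exact (isUnit_segOp (abs_smoothTransition_le_one t) (h N List.mem_cons_self)).mul
      (ih fun M hM ↦ h M (List.mem_cons_of_mem _ hM))

/-- `segProd l t * segProdInv l t = 1`. [folklore] -/
theorem segProd_mul_segProdInv {l : List (E →L[ℝ] E)} (h : ∀ N ∈ l, ‖N - 1‖ ≤ 1 / 6) (t : ℝ) :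
    segProd l t * segProdInv l t = 1 :=
  Ring.mul_inverse_cancel _ (isUnit_segProd h t)

/-- `segProdInv l t * segProd l t = 1`. [folklore] -/
theorem segProdInv_mul_segProd {l : List (E →L[ℝ] E)} (h : ∀ N ∈ l, ‖N - 1‖ ≤ 1 / 6) (t : ℝ) :
    segProdInv l t * segProd l t = 1 :=
  Ring.inverse_mul_cancel _ (isUnit_segProd h t)

/-- `segProd l t (segProdInv l t v) = v`. [folklore] -/
theorem segProd_segProdInv_apply {l : List (E →L[ℝ] E)} (h : ∀ N ∈ l, ‖N - 1‖ ≤ 1 / 6) (t : ℝ)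
    (v : E) : segProd l t (segProdInv l t v) = v :=
  calc segProd l t (segProdInv l t v) = (segProd l t * segProdInv l t) v := rfl
    _ = (1 : E →L[ℝ] E) v := by rw [segProd_mul_segProdInv h t]
    _ = v := rfl

/-- `segProdInv l t (segProd l t v) = v`. [folklore] -/
theorem segProdInv_segProd_apply {l : List (E →L[ℝ] E)} (h : ∀ N ∈ l, ‖N - 1‖ ≤ 1 / 6) (t : ℝ)
    (v : E) : segProdInv l t (segProd l t v) = v :=
  calc segProdInv l t (segProd l t v) = (segProdInv l t * segProd l t) v := rfl
    _ = (1 : E →L[ℝ] E) v := by rw [segProdInv_mul_segProd h t]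
    _ = v := rfl

/-- **Bound for the inverse**: `‖(segProd l t)⁻¹ v‖ ≤ (6/5)^m ‖v‖`. [folklore] -/
theorem norm_segProdInv_apply_le {l : List (E →L[ℝ] E)} (h : ∀ N ∈ l, ‖N - 1‖ ≤ 1 / 6) (t : ℝ)
    (v : E) : ‖segProdInv l t v‖ ≤ (6 / 5) ^ l.length * ‖v‖ := by
  simpa only [segProd_segProdInv_apply h t v] using
    norm_le_pow_mul_norm_segProd h t (segProdInv l t v)

/-- The inverse of the segment product is smooth in `t` (inversion is smooth on the units of a
complete normed algebra). [folklore] -/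
theorem contDiff_segProdInv {l : List (E →L[ℝ] E)} (h : ∀ N ∈ l, ‖N - 1‖ ≤ 1 / 6) :
    ContDiff ℝ ∞ (segProdInv l) := by
  refine contDiff_iff_contDiffAt.2 fun t ↦ ?_
  obtain ⟨u, hu⟩ := isUnit_segProd h t
  have hinv : ContDiffAt ℝ ∞ Ring.inverse (segProd l t) := by
    rw [← hu]
    exact contDiffAt_ringInverse ℝ u
  exact hinv.comp t (contDiff_segProd l).contDiffAt

end Segment

/-! ### The straightening path on `ℝ³`: a jointly smooth family of compactly supported diffeomorphisms -/

section PathFamily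

variable {ρ : ℝ}

/-- **The straightening path**: the iterated near-identity straightening
(`straightenListFun`, Hirsch's "inserting a bump function") of the segment list at time `t`,
`y ↦ S_{1 + λ(t)(N_1 - 1)} ∘ ⋯ ∘ S_{1 + λ(t)(N_m - 1)} (y)`. [cite: Hirsch1976, Ch. 8 §3, proof of Thm 3.1 (inserting a bump function)] -/
def straightenPathFun (ρ : ℝ) (l : List (𝔼 3 →L[ℝ] 𝔼 3)) (t : ℝ) : 𝔼 3 → 𝔼 3 :=
  straightenListFun ρ (segList l t)

/-- The straightening path of `N :: l`. [folklore] -/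
theorem straightenPathFun_cons (N : 𝔼 3 →L[ℝ] 𝔼 3) (l : List (𝔼 3 →L[ℝ] 𝔼 3)) (t : ℝ) :
    straightenPathFun ρ (N :: l) t =
      straightenFun coreBump ρ (segOp (Real.smoothTransition t) N) ∘ straightenPathFun ρ l t := by
  rw [straightenPathFun, segList_cons, straightenListFun_cons, straightenPathFun]

/-- The iterated straightening of a list of identity operators is the identity. [folklore] -/
theorem straightenListFun_eq_id_of_forall_eq_one {l : List (𝔼 3 →L[ℝ] 𝔼 3)} (h : ∀ L ∈ l, L = 1) :
    straightenListFun ρ l = id := by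
  induction l with
  | nil => rfl
  | cons L l ih =>
    rw [straightenListFun_cons, ih fun M hM ↦ h M (List.mem_cons_of_mem _ hM),
      h L List.mem_cons_self, straightenFun_one]
    rfl

/-- **At `t = 0` the straightening path is the identity.** [folklore] -/
@[simp] theorem straightenPathFun_zero (ρ : ℝ) (l : List (𝔼 3 →L[ℝ] 𝔼 3)) :
    straightenPathFun ρ l 0 = id :=
  straightenListFun_eq_id_of_forall_eq_one fun _ hL ↦ eq_one_of_mem_segList_zero l hL

/-- The straightening path fixes `0`. [folklore] -/
@[simp] theorem straightenPathFun_apply_zero (ρ : ℝ) (l : List (𝔼 3 →L[ℝ] 𝔼 3)) (t : ℝ) :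
    straightenPathFun ρ l t 0 = 0 :=
  straightenListFun_apply_zero _

/-- **The straightening path is jointly smooth in `(t, y)`.** [folklore] -/
theorem contDiff_straightenPathFun_uncurry (ρ : ℝ) (l : List (𝔼 3 →L[ℝ] 𝔼 3)) :
    ContDiff ℝ ∞ (uncurry (straightenPathFun ρ l)) := by
  induction l with
  | nil => exact contDiff_snd
  | cons N l ih =>
    have h : uncurry (straightenPathFun ρ (N :: l)) = fun p : ℝ × 𝔼 3 ↦
        straightenFun coreBump ρ (segOp (Real.smoothTransition p.1) N)
          (uncurry (straightenPathFun ρ l) p) := by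
      funext p
      rw [uncurry, straightenPathFun_cons]
      rfl
    rw [h]
    exact (contDiff_straightenFun_uncurry coreBump ρ).comp
      ((((contDiff_segOp N).comp Real.smoothTransition.contDiff).comp contDiff_fst).prodMk ih)

variable (hρ : 0 < ρ)
include hρ

/-- **Off `B(0, (17/5) ρ)` every stage of the straightening path is the identity.** [folklore] -/
theorem straightenPathFun_of_le_norm (l : List (𝔼 3 →L[ℝ] 𝔼 3)) (t : ℝ) {y : 𝔼 3}
    (hy : ρ * (17 / 5) ≤ ‖y‖) : straightenPathFun ρ l t y = y :=
  straightenListFun_of_le_norm hρ _ hy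

/-- **Every stage of the straightening path is a diffeomorphism** when all factors are within the
straightening threshold of `1`. [folklore] -/
theorem exists_diffeomorph_straightenPathFun {l : List (𝔼 3 →L[ℝ] 𝔼 3)}
    (h : ∀ N ∈ l, ‖N - 1‖ ≤ straightenThreshold (coreBump (E := 𝔼 3))) (t : ℝ) :
    ∃ D : 𝔼 3 ≃ₘ⟮𝓘(ℝ, 𝔼 3), 𝓘(ℝ, 𝔼 3)⟯ 𝔼 3, ⇑D = straightenPathFun ρ l t :=
  exists_diffeomorph_straightenListFun hρ _ (norm_sub_one_le_of_mem_segList h t)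

/-- **On `B̄(0, 3ρ (6/7)^m)` the stage at time `t` is the segment product** (factors within `1/6`
of `1`). [folklore] -/
theorem straightenPathFun_of_norm_le {l : List (𝔼 3 →L[ℝ] 𝔼 3)} (h : ∀ N ∈ l, ‖N - 1‖ ≤ 1 / 6)
    (t : ℝ) {y : 𝔼 3} (hy : ‖y‖ ≤ ρ * 3 * (6 / 7) ^ l.length) :
    straightenPathFun ρ l t y = segProd l t y := by
  have h' : ∀ L ∈ segList l t, ‖L‖ ≤ 7 / 6 := fun L hL ↦ by
    have h1 : ‖L - 1‖ ≤ 1 / 6 := norm_sub_one_le_of_mem_segList h t L hL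
    calc ‖L‖ = ‖L - 1 + 1‖ := by rw [sub_add_cancel]
      _ ≤ ‖L - 1‖ + ‖(1 : 𝔼 3 →L[ℝ] 𝔼 3)‖ := norm_add_le _ _
      _ ≤ 1 / 6 + 1 := add_le_add h1 ContinuousLinearMap.norm_id_le
      _ = 7 / 6 := by norm_num
  rw [straightenPathFun, straightenListFun_of_norm_le hρ _ h' (by rwa [length_segList])]
  rfl

end PathFamily

/-! ### The straightening diffeotopy of `ℝ³` and of `T³` -/

section Euclidean

variable (l : List (𝔼 3 →L[ℝ] 𝔼 3)) (hl : ∀ N ∈ l, ‖N - 1‖ ≤ fibreThreshold)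

/-- The scale of the bump: `ρ = 1/2`, so that the stages are supported in `B̄(0, 17/10)`, inside
the open cube of half-width `π`. [folklore] -/
def straightenScale : ℝ := 1 / 2

/-- The scale is positive. [folklore] -/
theorem straightenScale_pos : 0 < straightenScale := by unfold straightenScale; norm_num

include hl in
/-- Factors within `fibreThreshold` are within the straightening threshold. [folklore] -/
theorem le_straightenThreshold_of_fibre : ∀ N ∈ l, ‖N - 1‖ ≤ straightenThreshold (coreBump (E := 𝔼 3)) :=
  fun N hN ↦ (hl N hN).trans (min_le_left _ _)

include hl in
/-- Factors within `fibreThreshold` are within `1/6` of `1`. [folklore] -/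
theorem le_sixth_of_fibre : ∀ N ∈ l, ‖N - 1‖ ≤ 1 / 6 :=
  fun N hN ↦ (hl N hN).trans (min_le_right _ _)

/-- **The straightening diffeotopy of `ℝ³`** of a list of near-identity factors. [cite: Hirsch1976, Ch. 8 §3, proof of Thm 3.1 (inserting a bump function)] -/
def straightenDiffeotopy : Diffeotopy 𝓘(ℝ, 𝔼 3) (𝔼 3) :=
  Diffeotopy.ofFamily (straightenPathFun straightenScale l)
    (contDiff_straightenPathFun_uncurry straightenScale l)
    (exists_diffeomorph_straightenPathFun straightenScale_pos (le_straightenThreshold_of_fibre l hl))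
    (straightenPathFun_zero straightenScale l)

/-- Stages of the straightening diffeotopy (definitional). [folklore] -/
@[simp] theorem straightenDiffeotopy_toFun (t : ℝ) :
    (straightenDiffeotopy l hl).toFun t = straightenPathFun straightenScale l t := rfl

/-- The stages are the identity off `B̄(0, 17/10)`. [folklore] -/
theorem straightenDiffeotopy_toFun_of_le (t : ℝ) (v : 𝔼 3) (hv : 17 / 10 ≤ ‖v‖) :
    (straightenDiffeotopy l hl).toFun t v = v :=
  straightenPathFun_of_le_norm straightenScale_pos l t
    (by unfold straightenScale; linarith)

/-- `17/10 < π`. [folklore] -/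
theorem seventeen_tenths_lt_pi : (17 / 10 : ℝ) < π := by linarith [Real.pi_gt_three]

/-- **The radius of exact linearity**: `(3/4) (5/7)^m` for `m` factors — the forward stages are
linear on `B̄(0, (3/2)(6/7)^m)`, which contains both the cube of half-width `(3/4)(5/7)^m` and its
image under the inverse operators (of norm `≤ (6/5)^m`). [folklore] -/
def straightenRad : ℝ := 3 / 4 * (5 / 7) ^ l.length

/-- The radius is positive. [folklore] -/
theorem straightenRad_pos : 0 < straightenRad l := by unfold straightenRad; positivity

/-- `2 · straightenRad ≤ (3/2) (6/7)^m`. [folklore] -/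
theorem two_mul_straightenRad_le : 2 * straightenRad l ≤ straightenScale * 3 * (6 / 7) ^ l.length := by
  unfold straightenRad straightenScale
  have h : (5 / 7 : ℝ) ^ l.length ≤ (6 / 7) ^ l.length :=
    pow_le_pow_left₀ (by norm_num) (by norm_num) _
  nlinarith [h, pow_pos (show (0 : ℝ) < 5 / 7 by norm_num) l.length]

/-- `(6/5)^m · 2 · straightenRad ≤ (3/2) (6/7)^m`. [folklore] -/
theorem pow_mul_two_mul_straightenRad_le :
    (6 / 5) ^ l.length * (2 * straightenRad l) ≤ straightenScale * 3 * (6 / 7) ^ l.length := by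
  unfold straightenRad straightenScale
  rw [show (6 / 5 : ℝ) ^ l.length * (2 * (3 / 4 * (5 / 7) ^ l.length)) =
    3 / 2 * ((6 / 5) * (5 / 7)) ^ l.length by rw [mul_pow]; ring]
  norm_num

/-- `straightenRad < π`. [folklore] -/
theorem straightenRad_lt_pi : straightenRad l < π := by
  have h : (5 / 7 : ℝ) ^ l.length ≤ 1 := pow_le_one₀ (by norm_num) (by norm_num)
  unfold straightenRad
  nlinarith [Real.pi_gt_three]

include hl in
/-- **Exact linearity of the forward stages on the cube.** [folklore] -/
theorem straightenDiffeotopy_toFun_eq (t : ℝ) (v : 𝔼 3) (hv : ∀ i, |v i| < straightenRad l) :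
    (straightenDiffeotopy l hl).toFun t v = segProd l t v :=
  straightenPathFun_of_norm_le straightenScale_pos (le_sixth_of_fibre l hl) t
    ((norm_lt_two_mul_of_abs_lt hv).le.trans (two_mul_straightenRad_le l))

include hl in
/-- **Exact linearity of the inverse stages on the cube.** [folklore] -/
theorem straightenDiffeotopy_invFun_eq (t : ℝ) (v : 𝔼 3) (hv : ∀ i, |v i| < straightenRad l) :
    (straightenDiffeotopy l hl).invFun t v = segProdInv l t v := by
  have h6 := le_sixth_of_fibre l hl
  have hw : ‖segProdInv l t v‖ ≤ straightenScale * 3 * (6 / 7) ^ l.length :=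
    (norm_segProdInv_apply_le h6 t v).trans ((mul_le_mul_of_nonneg_left
      (norm_lt_two_mul_of_abs_lt hv).le (by positivity)).trans (pow_mul_two_mul_straightenRad_le l))
  have hfw : (straightenDiffeotopy l hl).toFun t (segProdInv l t v) = v := by
    rw [straightenDiffeotopy_toFun, straightenPathFun_of_norm_le straightenScale_pos h6 t hw,
      segProd_segProdInv_apply h6]
  conv_lhs => rw [← hfw]
  exact (straightenDiffeotopy l hl).invFun_toFun t _

/-- **The straightening diffeotopy of `T³`** of a list of near-identity factors: the extension by
the identity of the Euclidean one through exponential coordinates. [cite: GompfAGT2010, §3 ¶1 (straightening the linear diffeomorphism of T³ to the identity near 0)] -/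
def torusStraightenDiffeotopy : Diffeotopy 𝓣 ThreeTorus :=
  (straightenDiffeotopy l hl).torusExtend seventeen_tenths_lt_pi
    (straightenDiffeotopy_toFun_of_le l hl)

/-- Every stage fixes the base point. [folklore] -/
theorem torusStraightenDiffeotopy_based (t : ℝ) : (torusStraightenDiffeotopy l hl).toFun t 1 = 1 :=
  Diffeotopy.torusExtend_toFun_one _ _ _ t (straightenPathFun_apply_zero _ _ _)

include hl in
/-- **The stages in exponential coordinates**: linear with operator `segProd l t` on the cube of
half-width `straightenRad l`. [folklore] -/
theorem torusStraightenDiffeotopy_toFun_expT (t : ℝ) (v : 𝔼 3) (hv : ∀ i, |v i| < straightenRad l) :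
    (torusStraightenDiffeotopy l hl).toFun t (expT v) = expT (segProd l t v) := by
  rw [torusStraightenDiffeotopy, Diffeotopy.torusExtend_toFun_expT _ _ _ t
    fun j ↦ (hv j).trans (straightenRad_lt_pi l), straightenDiffeotopy_toFun_eq l hl t v hv]

include hl in
/-- The inverse stages in exponential coordinates. [folklore] -/
theorem torusStraightenDiffeotopy_invFun_expT (t : ℝ) (v : 𝔼 3)
    (hv : ∀ i, |v i| < straightenRad l) :
    (torusStraightenDiffeotopy l hl).invFun t (expT v) = expT (segProdInv l t v) := by
  rw [torusStraightenDiffeotopy, Diffeotopy.torusExtend_invFun_expT _ _ _ t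
    fun j ↦ (hv j).trans (straightenRad_lt_pi l), straightenDiffeotopy_invFun_eq l hl t v hv]

end Euclidean

/-! ### The linear straightening of `A ∈ SL(3, ℤ)` -/

section Linear

/-- `mulVecE (toMat f) v = f v`. [folklore] -/
theorem mulVecE_toMat (f : 𝔼 3 →L[ℝ] 𝔼 3) (v : 𝔼 3) : mulVecE (toMat f) v = f v := by
  rw [← matCLM_apply, matCLM_toMat]

variable (A : Matrix.SpecialLinearGroup (Fin 3) ℤ)

/-- **The linear straightening of `A`**: the straightening diffeotopy of `T³` of the near-identity
factors `straightenInvFactors A` of `A⁻¹`, with linear parts `G_t = ∏ₖ (1 + λ(t)(N_k - 1))`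
(`G_0 = 1`, `G_1 = A⁻¹`). Gompf 2010, §3 ¶1 ("straightening the corresponding linear
diffeomorphism of `T³` to the identity near `0`"), §4 Def. 4.1 (a straightening is a homotopy
class of paths in `GL(V)` from `A` to `I`) and ¶2; the construction is Hirsch's (1976), Ch. 8 §3,
proof of Thm 3.1. [cite: GompfAGT2010, Def. 4.1 and §4 ¶2 (X^σ depends only on the straightening class σ)] -/
def linearStraightening : Straightening A where
  D := torusStraightenDiffeotopy (straightenInvFactors A) (fun _ hL ↦
    norm_sub_one_le_of_mem_straightenInvFactors A hL)
  based := torusStraightenDiffeotopy_based _ _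
  G t := toMat (segProd (straightenInvFactors A) t)
  Ginv t := toMat (segProdInv (straightenInvFactors A) t)
  contDiff_G := contDiff_toMat_apply (contDiff_segProd _)
  contDiff_Ginv := contDiff_toMat_apply (contDiff_segProdInv (le_sixth_of_fibre _ fun _ hL ↦
    norm_sub_one_le_of_mem_straightenInvFactors A hL))
  G_mul_Ginv t := by
    rw [← toMat_mul, segProd_mul_segProdInv (le_sixth_of_fibre _ fun _ hL ↦
      norm_sub_one_le_of_mem_straightenInvFactors A hL), toMat_one]
  Ginv_mul_G t := by
    rw [← toMat_mul, segProdInv_mul_segProd (le_sixth_of_fibre _ fun _ hL ↦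
      norm_sub_one_le_of_mem_straightenInvFactors A hL), toMat_one]
  G_zero := by rw [segProd_zero, toMat_one]
  G_one := by rw [segProd_one, prod_straightenInvFactors, toMat_matCLM]
  R := straightenRad (straightenInvFactors A)
  R_pos := straightenRad_pos _
  toFun_expT t v hv := by
    rw [torusStraightenDiffeotopy_toFun_expT _ _ t v hv, mulVecE_toMat]
  invFun_expT t v hv := by
    rw [torusStraightenDiffeotopy_invFun_expT _ _ t v hv, mulVecE_toMat]

/-- **Every `A ∈ SL(3, ℤ)` admits a straightening with exactly linear germs.** [cite: GompfAGT2010, §3 ¶1 (straightening the linear diffeomorphism of T³ to the identity near 0)] -/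
theorem nonempty_straightening : Nonempty (Straightening A) := ⟨linearStraightening A⟩

/-- The linear parts of the linear straightening (definitional). [folklore] -/
@[simp] theorem linearStraightening_G (t : ℝ) :
    (linearStraightening A).G t = toMat (segProd (straightenInvFactors A) t) := rfl

/-- **Normal form in the class of the linear straightening**: for every framing path `γ` from `1`
to `A` homotopic to `(linearStraightening A).path`, Gompf's framed sphere `gompfSphere A γ` is
diffeomorphic to the product-framed surgery of the mapping torus of the straightened monodromy
`(linearStraightening A).monodromy` (which is the identity near the base point,
`Straightening.monodromy_expT`). [cite: GompfAGT2010, §4 ¶2 (X^{τ·σ}_ψ = X^σ_φ)] -/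
theorem nonempty_diffeomorph_gompfSphere_prodSphere_linearStraightening
    (γ : SmoothMatrixPath (slRealMatrix A))
    (hγ : γ.toPath.Homotopic (linearStraightening A).path.toPath) :
    Nonempty (gompfSphere A γ ≃ₘ⟮𝓡 4, 𝓡 4⟯ (linearStraightening A).prodSphere) :=
  (linearStraightening A).nonempty_diffeomorph_gompfSphere_prodSphere_of_homotopic γ hγ

end Linear

end Literature.Topology.FourManifolds
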